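import Literature.NumberTheory.EllipticCurves.CastellaGrossiSkinner2025.HeegnerPointMainConjecture
import Literature.NumberTheory.EllipticCurves.CastellaGrossiLeeSkinner2022.IMC2DivisibilityAndBDPValueFrame
import HarnessLib

/-!
# Castella–Grossi–Skinner 2025, printed §6.5 "The anticyclotomic Iwasawa main conjectures": Thm. 6.5.2 (the Howard-type Heegner-point Kolyvagin bound under `E(K)[p] = 0` ALONE, in `Λ[1/p]`) and Thm. 6.5.3 (the Iwasawa–Greenberg / BDP anticyclotomic main conjecture at a non-anomalous Eisenstein prime, WITHOUT the corank-one hypothesis (Sel))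

HONEST FRAMING (cell `bsd-littype` = BSD share of the cross-ladder LITERATURE-TYPING layer,
D-0088(4); seat `bsd-littype-02`, run/shared/lean/pub/bsd-littype/): typed ≠ proved ≠ endorsed; no
tranche here proves BSD. This file TYPES two PUBLISHED theorems of ONE printed section of one
refereed paper as named facts (`def … : Prop`, nothing asserted; D-0014/D-0026), each in the EXISTING
tree vocabulary of an already-typed sibling, and proves only bookkeeping consequences. The lettered
theorems are already in the tree and are NOT restated: A = `thmA_charIdeal_eq_padicLFunction`
(`MazurMainConjecture.lean`), C = `thmC_charIdeal_torsion_eq_heegnerCharIdeal_sq`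
(`HeegnerPointMainConjecture.lean`), D = `thmD_padicValRat_bsd_rank_le_one` (`EisensteinPPartBSD.lean`).
"Theorem B" does not exist: the Introduction's `\Alph`-numbered environments are A = `thm:CYC`,
**B = `conj:PR` = CONJECTURE B (Perrin-Riou's Heegner point main conjecture;
`\newtheorem{conj}[thmintro]` shares the counter, final TeX l.107–109)**, C = `thm:AC`, D = `thm:pBSD`.

WHY THESE TWO. Neither passes through the Beilinson–Flach classes of printed Thm. 4.1.1 ("proved in
[BSTW23, §5]" = arXiv:2409.01350 §5, PREPRINT — cell flag `CGS25-BST-Thm311`): their printed proofs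
are §6 (Kolyvagin systems with error terms) + [CGLS22] §§2–4 + Howard 2004 + Cornut–Vatsal + [BCK21]
(+ Rubin / Hida / Kriz invariants for 6.5.3), all refereed. Thm. 6.5.2 = Howard's Thm. B (b)(c) with
"`G_K ↠ Aut(T_pE)`" REPLACED by `E(K)[p] = 0` at the price of inverting `p` (= [CGLS22] Thm. 4.1.2
with the localisation at `(γ − 1)` and (Sel) removed); Thm. 6.5.3 = [CGLS22] Thm. 4.2.2 WITHOUT (Sel)
— the tree's CGLS22 facts `proofThm422_…` and `display54_…` both CARRY (Sel).

## Citation header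

* F. Castella, G. Grossi, C. Skinner, *Mazur's main conjecture at Eisenstein primes*, Math. Ann.
  **393** (2025) 2451–2506, doi:10.1007/s00208-025-03239-x = arXiv:2303.04373v2 (2025-10-15, "Final
  version"); bib key `CastellaGrossiSkinner2025`; REFEREED / PUBLISHED (journal pagination cite-only,
  want acq-08184). Texts read: the FINAL TeX `Mazur-paper_revised.tex` (3469 lines, held at
  `run/shared/lean/b2b/bsd-rank1-residual/b2b-bsdres-lit-cgls/src/cgs25-final/`, SHA256SUMS there) —
  all locators `l.NNNN` — and the store's LaTeXML text of arXiv v1 `[corpus: paper:arxiv-2303.04373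
  pNNNN]`. PRINTED NUMBERING = final TeX (`\newtheorem{thm}{Theorem}[subsection]`, Introduction = §1);
  v1 numbers each body item one SECTION lower (Introduction = §0), given in brackets below.

### v1 ↔ print numbering table (whole paper, from the final TeX environments)

§1: Thm A `thm:CYC` l.382 [v1 Thm 1]; Conj B `conj:PR` l.476 [Conj 2]; Thm C `thm:AC` l.506 [Thm 3];
Thm D `thm:pBSD` l.591, §1.2 [Thm 4, §0.3]; Rem 1.2.1; §1.3 Further applications (Kolyvagin's
conjecture at Eisenstein primes → forthcoming [BCGS]). §2: Thm 2.1.1 `thm:MSD` l.734 [1.1.1];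
Thm 2.2.1 `thm:PR` [1.2.1]; Def 2.2.2; Rem 2.2.3; Prop 2.2.4 `prop:comp-Lcyc` l.849 [1.2.4]; Thm 2.3.1
`thm:BDP` l.907 [1.3.1]; Rmk 2.3.2; Thm 2.4.1 `thm:Gr` l.942 [1.4.1]; Thm 2.4.2 `thm:katz` [1.4.2];
Def 2.4.3 `def:Gr`; Lemma 2.4.4; Prop 2.4.5 `prop:comp-Lac` l.1021 [1.4.5]; Lemma 2.5.1 `lem:cong-L`
[1.5.1]; Def 2.5.2. §3: Def 3.1.1 `defilocalconds` [2.1.1]; Conj 3.2.1 Mazur `conj:IMC` l.1177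
[2.1.2]; Conj 3.2.2 Greenberg `conj:IMC-K` l.1187 [2.1.3]; Prop 3.2.3 `prop:isog-inv` [2.1.4];
Prop 3.3.1 `prop:comp-Selcyc` l.1271 [2.2.1]; Prop 3.3.2 [2.2.2]; Cor 3.3.3 `cor:imp-IMC` [2.2.3];
Lemma 3.4.1 `lem:coinv` [2.3.1]; Prop 3.4.2 `prop:euler-char` [2.3.2]; Lemma 3.4.3 [2.3.3]; Prop 3.4.4
`prop:cong-Sel` [2.3.4]. §4: **Thm 4.1.1 `thm:KLZ` l.1682 [3.1.1] ("This is proved in [BSTW23, §5]",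
l.1701–1702; v1 "[BST, §5]")**; Lemma 4.1.2 [3.1.2]; Cor 4.1.3 `cor:KLZ` l.1853 [3.1.3]; Prop 4.2.1
`prop:equiv` l.1895 [3.2.1]; Thm 4.3.1 `thm:BF-ES` l.1957 [3.3.1]. §5 Interlude (none). §6: Thm 6.1.1
`thm:Zp-twisted` l.2301 [5.1.1]; Lemma 6.2.1; Prop 6.2.2; Prop 6.3.1 `prop:prime2` [5.3.1]; Rmk 6.3.2;
Rmk 6.4.1; **Thm 6.5.1 `thm:howard` l.3213 [5.5.1]; Thm 6.5.2 `thm:howard-HP` l.3231 [5.5.2];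
Thm 6.5.3 `thm:BDP-IMC` l.3246 [5.5.3]; Cor 6.5.4 `cor:PR` l.3258 = Thm C [5.5.4]**. §7: Thm 7.1.1
`thm:A` l.3277 = Thm A [6.0.5]; Lemma 7.2.1 [6.1.1]; Lemma 7.2.2 [6.1.2]; Thm 7.2.3 `thm:PR-IMC`
l.3422 [6.1.3].

### The two theorems, verbatim (final TeX)

§6 standing (l.2258–2262): "Throughout this section, we let `E/ℚ` be an elliptic curve of conductor
`N`, `p ∤ 2N` be a prime of good ordinary reduction for `E`, and `K` be an imaginary quadratic field
of discriminant `D_K` prime to `Np`. We assume that (h1) `E(K)[p] = 0`." §6.5 (l.3201–3211): "Let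
`Λ = Λ_K⁻` … the modules `𝒳 = H¹_{𝓕_Λ}(K, M_E)^∨`, `H¹_{𝓕_Λ}(K, 𝐓)` in [CGLS22, §3.4] are the same as
the modules `𝔛_ord(E/K_∞⁻)` and `𝔖_ord(E/K_∞⁻)` in §3.1, respectively."

> **Theorem 6.5.2** (l.3231–3238). Assume `E(K)[p] = 0`. Then `𝔖_ord(E/K_∞⁻)` has `Λ`-rank one, and
> there is a finitely generated torsion `Λ`-module `M` such that (i) `𝔛_ord(E/K_∞⁻) ∼ Λ ⊕ M ⊕ M`,
> (ii) `char_Λ(M)` divides `char_Λ(𝔖_ord(E/K_∞⁻)/Λκ₁^{Hg})` in `Λ[1/p]`.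

Lead-in (l.3229): "Applying Theorem 6.5.1 to the Kolyvagin system `κ^{Hg}` of [CGLS22, Thm. 4.1.1], we
thus obtain the following" — [CGLS22] Thm. 4.1.1 is stated under [CGLS22] §4.1 standing = the §6
standing here "+ (Heeg) and (disc)" (arXiv:2008.02571v2 TeX l.2186); its proof covers `p ∣ h_K`
(l.2246) and both `p` split and `p` inert (the multiplier `Φ`, l.2222–2229).

> **Theorem 6.5.3** (l.3246–3254). Suppose `K` satisfies hypotheses (Heeg), (spl), and (disc), and
> that `E[p]^{ss} = 𝔽_p(φ) ⊕ 𝔽_p(ψ)` as `G_ℚ`-modules, with `φ|_{G_p} ≠ 𝟙, ω`. Then `𝔛_Gr(E/K_∞⁻)` is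
> `Λ`-torsion, and `char_Λ(𝔛_Gr(E/K_∞⁻))Λ^ur = (𝓛_p^{BDP}(f/K))` as ideals in `Λ^ur`. Hence the
> anticyclotomic Iwasawa–Greenberg main conjecture in Conjecture 3.2.2 holds.

with (l.442–448, 487–489) (disc) "`D_K` is odd and `D_K ≠ −3`", (Heeg) "every prime `ℓ ∣ N` splits in
`K`", (spl) "`(p) = v v̄` splits in `K`"; `𝔛_Gr(E/K_∞⁻) = H¹_{𝓕_{rel,str}}(K, T_pE ⊗ (Λ_K⁻)^∨)^∨`
(relaxed at `v`, strict at `v̄`; Def. 3.1.1, l.1130–1165); `𝓛_p^{BDP}(f/K) ∈ Λ_K^{−,ur}` the NONZERO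
Bertolini–Darmon–Prasanna `p`-adic `L`-function of Thm. 2.3.1 ("See [CGLS22, Thm. 2.1.1], which is a
reformulation of [CH18, §3.3]"); `Λ^ur = Λ ⊗̂ ℤ_p^ur`. Printed proof (l.3243–3244): "Using this
[Thm. 6.5.2], we conclude just as for [CGLS22, Thm. 4.2.2]" (Thm. 6.5.2 + [CGLS22] Rem. 4.1.3 +
Prop. 4.2.1 = [BCK21, Thm. 5.2] for one divisibility in `Λ^ur ⊗ ℚ_p`, then the Iwasawa-invariant
equalities of [CGLS22] Thm. 2.2.3 under `φ|_{G_p} ≠ 𝟙, ω`).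

## Hypotheses, enumerated (word for word → tree predicate)

Thm. 6.5.2, bundled as `Thm652Hypotheses N W K p κ γ` (pattern of `ThmCHypotheses`): field by field
in its docstring; NO image / splitting / parity / Selmer-corank hypothesis; EXTRA, NOT PRINTED
(special case, exactly as `ThmCHypotheses` item 6, same reason): `not_dvd_classNumber : p ∤ h_K` — the
tree's `HeegnerFamily` and the transcription of `Λκ₁^{Hg}` as Howard's Heegner MODULE
`heegnerModule D F` (Howard 2004 Thm. 3.3.7) need it; CGS/CGLS allow `p ∣ h_K`. Conclusion for every
`Λ`-adic Selmer datum `D` (`𝔖_ord`), Heegner family `F` at level `N`, Selmer-dual datum `X` (`𝔛_ord`):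
`𝔖`, `𝔛` finitely generated of `Λ`-rank one, and there are an ideal `J ⊆ Λ` (`= char_Λ(M)`) and
`k ∈ ℕ` with `char_Λ(𝔛_{Λ-tors}) = J²` ((i)) and `J ∣ (p^k)·char_Λ(𝔖/𝐇)` ((ii), principal ideals of
the UFD `Λ`) — as in `Howard2004_thmB`, (i) is recorded only through invariants (WEAKER, never stronger).

Thm. 6.5.3: the binders of the CGLS22 sibling `proofThm422_…` (same objects, same `IsBDPLFunction`
frame, `𝔛_Gr = AcSelmer.XAc (W.baseChange K) p κ vbar ∅ γ`) with (Sel) DELETED and the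
isogeny-character hypothesis in the cell's spelling `2 < p`, `Good W p`, `Red W p`, `¬ Anom W p`
(`a_p ≢ 1 (mod p) ⟺ φ|_{G_p} ∉ {𝟙, ω}`, tree `Rank1Residual.not_anom_iff_cgs_of_mem_primesAbove`), as in
Theorems A, C, D; (h1) kept as printed (§6 standing; implied by `φ|_{G_p} ≠ 𝟙, ω` + (spl), [CGLS22]
proof of Thm. 5.3.1); the equality of extended ideals along THE structure map `j : ℤ_p → R₀` is
invariant under `L ↦ U·L`, `U ∈ R₀⟦T⟧ˣ`, so nothing beyond print is asserted.

NOT TYPED HERE (no tree vocabulary; typed-GAP rows of the seat's sheet): Thm. 6.5.1/6.1.1 (Λ-adic /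
`R(α)`-twisted Kolyvagin systems as hypotheses), Thm. 4.1.1/Cor. 4.1.3/Prop. 4.2.1/Thm. 4.3.1
(two-variable Iwasawa cohomology, Coleman maps, Hida's two-variable Rankin `L`-series), Thm. 7.2.3.
D-0026: exactly TWO named facts (two printed theorems of one section) + proved consumers; no `_holds`
is to be expected.

## References
* [CastellaGrossiSkinner2025] Math. Ann. 393 (2025) 2451–2506 = arXiv:2303.04373v2: §6 standing
  (l.2258–2262), §6.5 (l.3201–3266), Thm. 2.3.1 (l.907), Def. 3.1.1 / Conj. 3.2.2 (l.1130, l.1187),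
  §1.1 (l.440–520); v1 = [corpus: paper:arxiv-2303.04373 p0026, p0008, p0011].
* [CastellaGrossiLeeSkinner2022] Invent. Math. 227 (2022) = arXiv:2008.02571v2: §3.2 (l.1253–1262),
  §4.1 + Thm. 4.1.1 (l.2180–2249), Thm. 4.1.2 (l.2253–2260), Rem. 4.1.3, Prop. 4.2.1, Thm. 4.2.2 —
  tree `CastellaGrossiLeeSkinner2022/IMC2DivisibilityAndBDPValueFrame.lean`, `BDPValueAtTrivialCharacter.lean`.
* [Howard2004HeegnerKolyvagin] Compositio 140 (2004) Thm. B, Thm. 3.3.7 — tree `HeegnerModuleIndex.lean`.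
* [BurungaleCastellaKim2021] Thm. 5.2; [CastellaHsieh2018] §3.3 (the BDP `L`-function);
  [PerrinRiou1987BSMF] (the source of Conjecture B).
-/

noncomputable section

open scoped Classical
open PowerSeries WeierstrassCurve NumberField IsDedekindDomain Field
  Literature.NumberTheory.EllipticCurves Literature.NumberTheory.EllipticCurves.ModularForms
  Literature.NumberTheory.QuadraticFields Literature.NumberTheory.EllipticCurves.Rank1Residual
  Literature.NumberTheory.EllipticCurves.Castella2018

universe u

namespace Literature.NumberTheory.EllipticCurves.CastellaGrossiSkinner2025

/-! ## Theorem 6.5.2 — the Heegner-point Kolyvagin bound under `E(K)[p] = 0`, in `Λ[1/p]` -/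

section Thm652

variable (N : ℕ) [NeZero N] (W : WeierstrassCurve ℚ) [W.IsGloballyMinimal] (K : Type u) [Field K]
  [NumberField K] (p : ℕ) [Fact p.Prime] (κ : ZpExtension K p) (γ : Field.absoluteGaloisGroup K)
  (jbar : AlgebraicClosure K →+* ℂ)

/-- **Hypotheses of Castella–Grossi–Skinner 2025, Theorem 6.5.2** in the tree's vocabulary (module
docstring): the §6 standing hypotheses "`E/ℚ` an elliptic curve of conductor `N`, `p ∤ 2N` a prime
of good ordinary reduction, `K` an imaginary quadratic field of discriminant `D_K` prime to `Np`,
(h1) `E(K)[p] = 0`", the standing hypotheses (Heeg) and (disc) of the Heegner-point Kolyvagin system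
`κ^{Hg}` of [CGLS22, Thm. 4.1.1] to which Thm. 6.5.1 is applied, `κ` the anticyclotomic
`ℤ_p`-extension with topological generator `γ`, and the EXTRA standing hypothesis `p ∤ h_K` of the
tree's Heegner-family vocabulary (Howard 2004 Thm. 3.3.7; not printed by CGS — special case). NO
hypothesis on the Galois image of `E[p]`, on the splitting of `p` in `K`, on parity, or on the Selmer
corank. [cite: CastellaGrossiSkinner2025, §6 standing hypotheses (final TeX l.2258–2262) and Thm. 6.5.2 (l.3229–3238)]
[cite: CastellaGrossiLeeSkinner2022, §4.1 (standing hypotheses (Heeg), (disc) of Thm. 4.1.1, arXiv v2 TeX l.2186)] -/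
structure Thm652Hypotheses : Prop where
  /-- `E` is an elliptic curve. -/
  isElliptic : W.IsElliptic
  /-- `N` is the conductor of `E` (the level of the Heegner family). -/
  level : N = W.conductorNorm ℤ
  /-- `p ∤ 2`. -/
  p_ne_two : p ≠ 2
  /-- `p ∤ N` and good ORDINARY reduction at `p` (`p ∤ a_p`). -/
  ordinary : IsOrdinaryAt W p
  /-- `K` is imaginary quadratic. -/
  isImaginaryQuadratic : IsImaginaryQuadratic K
  /-- `D_K` is prime to `p` (prime to `N` follows from (Heeg)). -/
  not_dvd_discr : ¬ (p : ℤ) ∣ NumberField.discr K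
  /-- (h1): `E(K)[p] = 0`. -/
  noPTorsion : ∀ Q : (W.baseChange K).toAffine.Point, p • Q = 0 → Q = 0
  /-- (Heeg): every prime dividing `N` splits in `K` (standing for `κ^{Hg}`). -/
  heegner : SatisfiesHeegnerHypothesis N K
  /-- (disc), first half: `D_K` is odd (standing for `κ^{Hg}`). -/
  discr_odd : Odd (NumberField.discr K)
  /-- (disc), second half: `D_K ≠ -3`. -/
  discr_ne : NumberField.discr K ≠ -3
  /-- EXTRA (special case, Howard 2004 Thm. 3.3.7 / tree Heegner families): `p ∤ h_K`. -/
  not_dvd_classNumber : ¬ p ∣ NumberField.classNumber K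
  /-- `κ` is the anticyclotomic `ℤ_p`-extension of `K`. -/
  anticyclotomic : κ.IsAnticyclotomic
  /-- `γ` is a topological generator of `Gal(K_∞⁻/K)`. -/
  topGenerator : κ.IsTopGenerator γ

-- TODO(general form): CGS 2025 Thm. 6.5.2 / CGLS 2022 Thm. 4.1.1 allow `p ∣ h_K` (norms from
-- `K[np^{d(k)}]`, `d(k) = min {d : K_k ⊂ K[p^d]}`); the field `not_dvd_classNumber` is the tree
-- vocabulary's standing hypothesis under which `heegnerModule D F = Λκ₁^{Hg}` (Howard Thm. 3.3.7).

/-- **Castella–Grossi–Skinner, Math. Ann. 393 (2025) 2451–2506 = arXiv:2303.04373v2, Theorem 6.5.2**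
(`thm:howard-HP`, final TeX l.3231–3238; v1 Thm. 5.5.2), verbatim: "Assume `E(K)[p] = 0`. Then
`𝔖_ord(E/K_∞⁻)` has `Λ`-rank one, and there is a finitely generated torsion `Λ`-module `M` such that
(i) `𝔛_ord(E/K_∞⁻) ∼ Λ ⊕ M ⊕ M`, (ii) `char_Λ(M)` divides `char_Λ(𝔖_ord(E/K_∞⁻)/Λκ₁^{Hg})` in
`Λ[1/p]`" — under the §6 standing hypotheses, for the Kolyvagin system `κ^{Hg}` of [CGLS22,
Thm. 4.1.1] (stated under (Heeg), (disc)). Tree reading (as in the sibling `thmC_…` and in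
`Howard2004_thmB`): `𝔖_ord = lim←_n lim←_m Sel_{p^m}(E/K_n⁻)` is a `LambdaAdicSelmerData` `D` (`D.S`),
`𝔛_ord = Sel_{p^∞}(E/K_∞⁻)^∨` a `SelmerDualData` `X` (`X.X`), `Λκ₁^{Hg}` = Howard's Heegner module
`heegnerModule D F` of a Heegner family `F` at level `N = N_E` (`= Λκ̃₁`, Howard 2004 Thm. 3.3.7,
under `p ∤ h_K`), so `char_Λ(𝔖/Λκ₁^{Hg}) = heegnerCharIdeal D F`. Recorded under `Thm652Hypotheses`
through invariants of the printed pseudo-isomorphism (WEAKER, never stronger): `𝔖` and `𝔛` finitely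
generated of `Λ`-rank one, and there are an ideal `J ⊆ Λ` (`= char_Λ(M)`) and `k ∈ ℕ` with
`char_Λ(𝔛_{Λ-tors}) = J²` and `J ∣ (p^k)·char_Λ(𝔖/𝐇)`. = Howard 2004 Thm. B (b)(c) with the image
hypothesis "`G_K ↠ Aut_{ℤ_p}(T_pE)`" REPLACED by `E(K)[p] = 0`, at the price of the power of `p`;
= [CGLS22] Thm. 4.1.2 with the localisation at `(γ − 1)` and (Sel) REMOVED. PUBLISHED THEOREM (proof:
§6 + [CGLS22] §3 + Howard + Cornut–Vatsal; no Beilinson–Flach classes).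
[cite: CastellaGrossiSkinner2025, Thm. 6.5.2 (final TeX `thm:howard-HP` l.3231–3238; v1 Thm. 5.5.2) with §6 standing hypotheses (l.2258–2262) and §6.5 identifications (l.3201–3211)]
[cite: CastellaGrossiLeeSkinner2022, Thm. 4.1.1 (the Kolyvagin system κ^{Hg}, arXiv v2 TeX l.2203–2249) and Thm. 4.1.2 (predecessor with (Sel), l.2253–2260)]
[cite: Howard2004HeegnerKolyvagin, Thm. B and Thm. 3.3.7 (transcription of Λκ₁^{Hg} as the Heegner module)] -/
def thm652_rankOne_charIdeal_torsion_eq_sq_dvd : Prop :=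
  ∀ (_ : Thm652Hypotheses N W K p κ γ) (D : (W.baseChange K).LambdaAdicSelmerData κ γ)
    (F : HeegnerFamily N W K κ jbar) (X : (W.baseChange K).SelmerDualData κ γ),
    (Module.Finite (IwasawaAlgebra p) D.S ∧ Module.finrank (IwasawaAlgebra p) D.S = 1) ∧
    (Module.Finite (IwasawaAlgebra p) X.X ∧ Module.finrank (IwasawaAlgebra p) X.X = 1 ∧
      ∃ (J : Ideal (IwasawaAlgebra p)) (k : ℕ),
        Module.charIdeal (IwasawaAlgebra p) (Submodule.torsion (IwasawaAlgebra p) X.X) = J ^ 2 ∧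
        J ∣ Ideal.span {(p : IwasawaAlgebra p) ^ k} * heegnerCharIdeal D F)

variable {N W K p κ γ jbar}

/-- **Theorem 6.5.2 ⇒ the "upper bound" half of Conjecture B up to a power of `p`**:
`char_Λ(𝔛_tors) ∣ (p^{2k})·char_Λ(𝔖/𝐇)²` — `Howard2004_thmB`'s third clause weakened by the power of
`p`, WITHOUT any Galois-image hypothesis. [cite: CastellaGrossiSkinner2025, Thm. 6.5.2 (i)–(ii)] -/
theorem charIdeal_torsion_dvd_of_thm652 (h : thm652_rankOne_charIdeal_torsion_eq_sq_dvd N W K p κ γ jbar)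
    (hyp : Thm652Hypotheses N W K p κ γ) (D : (W.baseChange K).LambdaAdicSelmerData κ γ)
    (F : HeegnerFamily N W K κ jbar) (X : (W.baseChange K).SelmerDualData κ γ) :
    ∃ k : ℕ, Module.charIdeal (IwasawaAlgebra p) (Submodule.torsion (IwasawaAlgebra p) X.X) ∣
      Ideal.span {(p : IwasawaAlgebra p) ^ (2 * k)} * heegnerCharIdeal D F ^ 2 := by
  obtain ⟨-, -, -, J, k, hJ, hdvd⟩ := h hyp D F X
  refine ⟨k, ?_⟩
  rw [hJ, pow_mul', ← Ideal.span_singleton_pow, ← mul_pow]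
  exact pow_dvd_pow_of_dvd hdvd 2

omit [NeZero N] in
/-- The hypotheses of Theorem 6.5.2 make `p` odd, of good reduction, and ordinary in the cell's
spelling `GoodOrd` (definitional bookkeeping between `IsOrdinaryAt` and `Rank1Residual.GoodOrd`).
[cite: CastellaGrossiSkinner2025, §6 standing hypotheses (l.2258–2262)] -/
theorem Thm652Hypotheses.two_lt_and_goodOrd (hyp : Thm652Hypotheses N W K p κ γ) :
    2 < p ∧ Good W p ∧ GoodOrd W p := by
  have h2 := (Fact.out : p.Prime).two_le; have hne := hyp.p_ne_two
  have hord := (isOrdinaryAt_iff W p).mp hyp.ordinary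
  exact ⟨by omega, hord.1, hord⟩

omit [NeZero N] in
/-- **Theorem C's setting lies inside Theorem 6.5.2's**, given the two conditions that Theorem C's
hypotheses imply but that the tree does not derive: (h1) `E(K)[p] = 0` ("The hypotheses on `φ` imply
that `E(K)[p] = 0`", [CGLS22] proof of Thm. 5.3.1, from `φ|_{G_p} ≠ 𝟙, ω` and (spl)) and `p ∤ D_K`
(from (spl): a split prime is unramified). Ordinarity comes from the tree theorem
`goodOrd_of_red_of_good` (an Eisenstein prime `p > 2` of good reduction is ordinary).
[cite: CastellaGrossiSkinner2025, Thm. C (§1.1) and Thm. 6.5.2 (hypotheses compared)]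
[cite: CastellaGrossiLeeSkinner2022, proof of Thm. 5.3.1 ("The hypotheses on φ imply that E(K)[p] = 0")] -/
theorem Thm652Hypotheses.of_thmCHypotheses (hC : ThmCHypotheses N W K p κ γ)
    (h1 : ∀ Q : (W.baseChange K).toAffine.Point, p • Q = 0 → Q = 0)
    (hD : ¬ (p : ℤ) ∣ NumberField.discr K) : Thm652Hypotheses N W K p κ γ where
  isElliptic := hC.isElliptic
  level := hC.level
  p_ne_two := hC.p_ne_two_and_goodOrd.1
  ordinary := (isOrdinaryAt_iff W p).mpr hC.p_ne_two_and_goodOrd.2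
  isImaginaryQuadratic := hC.isImaginaryQuadratic
  not_dvd_discr := hD
  noPTorsion := h1
  heegner := hC.heegner
  discr_odd := hC.discr_odd
  discr_ne := hC.discr_ne
  not_dvd_classNumber := hC.not_dvd_classNumber
  anticyclotomic := hC.anticyclotomic
  topGenerator := hC.topGenerator

/-- **Consistency with Theorem C**: where both apply, Theorem C's EQUALITY
`char_Λ(𝔛_tors) = char_Λ(𝔖/𝐇)²` refines Theorem 6.5.2's divisibility with `J = char_Λ(𝔖/𝐇)`,
`k = 0` — recorded as the implication "Thm. C's conclusion ⇒ Thm. 6.5.2's conclusion" on the data.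
[cite: CastellaGrossiSkinner2025, Cor. 6.5.4 (= Thm. C) and Thm. 6.5.2] -/
theorem thm652Conclusion_of_thmC (h : thmC_charIdeal_torsion_eq_heegnerCharIdeal_sq N W K p κ γ jbar)
    (hC : ThmCHypotheses N W K p κ γ) (D : (W.baseChange K).LambdaAdicSelmerData κ γ)
    (F : HeegnerFamily N W K κ jbar) (X : (W.baseChange K).SelmerDualData κ γ) :
    (Module.Finite (IwasawaAlgebra p) D.S ∧ Module.finrank (IwasawaAlgebra p) D.S = 1) ∧
    (Module.Finite (IwasawaAlgebra p) X.X ∧ Module.finrank (IwasawaAlgebra p) X.X = 1 ∧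
      ∃ (J : Ideal (IwasawaAlgebra p)) (k : ℕ),
        Module.charIdeal (IwasawaAlgebra p) (Submodule.torsion (IwasawaAlgebra p) X.X) = J ^ 2 ∧
        J ∣ Ideal.span {(p : IwasawaAlgebra p) ^ k} * heegnerCharIdeal D F) := by
  obtain ⟨hS, hXf, hXr, heq⟩ := h hC D F X
  refine ⟨hS, hXf, hXr, heegnerCharIdeal D F, 0, heq, ?_⟩
  simp

end Thm652

/-! ## Theorem 6.5.3 — the BDP / Iwasawa–Greenberg anticyclotomic main conjecture at a
non-anomalous Eisenstein prime, WITHOUT (Sel) -/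

section Thm653

/-- **Castella–Grossi–Skinner, Math. Ann. 393 (2025) 2451–2506 = arXiv:2303.04373v2, Theorem 6.5.3**
(`thm:BDP-IMC`, final TeX l.3246–3254; v1 Thm. 5.5.3), verbatim: "Suppose `K` satisfies hypotheses
(Heeg), (spl), and (disc), and that `E[p]^{ss} = 𝔽_p(φ) ⊕ 𝔽_p(ψ)` as `G_ℚ`-modules, with
`φ|_{G_p} ≠ 𝟙, ω`. Then `𝔛_Gr(E/K_∞⁻)` is `Λ`-torsion, and `char_Λ(𝔛_Gr(E/K_∞⁻))Λ^ur = (𝓛_p^{BDP}(f/K))`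
as ideals in `Λ^ur`" [hence the anticyclotomic Iwasawa–Greenberg main statement of its Conj. 3.2.2]
— under the §6 standing hypotheses (`E/ℚ` of conductor `N`, `p ∤ 2N` good ordinary, `D_K` prime to
`Np`, (h1) `E(K)[p] = 0`), with `𝔛_Gr = H¹_{𝓕_{rel,str}}(K, T_pE ⊗ (Λ_K⁻)^∨)^∨` (relaxed at `v`, strict
at `v̄`) and `𝓛_p^{BDP}(f/K) ∈ Λ^{−,ur}` the nonzero BDP `p`-adic `L`-function of Thm. 2.3.1. Binders of
the CGLS22 sibling `proofThm422_exists_isBDPLFunction_isTorsion_charIdeal_dvd` — `W` globally minimal,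
`f` its newform at level `N`; `K` imaginary quadratic with (Heeg), (spl), (disc), (h1); `v` from the
embedding datum `ι'`, `v̄ ∋ p` the other prime; `κ` anticyclotomic with topological generator `γ`;
`𝔛_Gr = AcSelmer.XAc (W.baseChange K) p κ vbar ∅ γ` — with (Sel) DELETED and the isogeny-character
hypothesis in the cell's spelling `2 < p`, `Good W p`, `Red W p`, `¬ Anom W p`. Conclusion: there are
`Ω_K ≠ 0`, `Ω_p ∈ R₀ˣ`, `L ∈ R₀⟦T⟧` with `IsBDPLFunction ι' v κ γ f Ω_K Ω_p L` such that `𝔛_Gr` is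
`Λ`-torsion and, along THE structure map `j : ℤ_p → R₀` (`j(x) = x` in `ℂ_p`),
`(char_Λ 𝔛_Gr)·R₀⟦T⟧ = (L)` — invariant under `L ↦ U·L`, `U ∈ R₀⟦T⟧ˣ`. The predecessor [CGLS22]
Thm. 4.2.2 and the tree's `display54_…` / `proofThm422_…` carry (Sel); this does not. PUBLISHED
THEOREM (proof: Thm. 6.5.2 + [CGLS22] §§2, 4 + [BCK21]; no Beilinson–Flach classes).
[cite: CastellaGrossiSkinner2025, Thm. 6.5.3 (final TeX `thm:BDP-IMC` l.3246–3254; v1 Thm. 5.5.3) with §6 standing hypotheses (l.2258–2262), Def. 3.1.1 (𝔛_Gr, l.1130–1165), Thm. 2.3.1 (𝓛_p^{BDP}, l.907)]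
[cite: CastellaGrossiLeeSkinner2022, Thm. 4.2.2 (the predecessor under (Sel)) and Thm. 2.1.1 (the frame of 𝓛_E)]
[cite: CastellaHsieh2018, Prop. 3.8 (construction of the BDP p-adic L-function)] -/
def thm653_exists_isBDPLFunction_isTorsion_charIdeal_map_eq : Prop :=
  ∀ {p : ℕ} [Fact p.Prime] (ι' : PadicAlgCl p ≃+* ℂ) (W : WeierstrassCurve ℚ) [W.IsElliptic]
    [W.IsGloballyMinimal] (K : Type) [Field K] [NumberField K] (v vbar : HeightOneSpectrum (𝓞 K))
    (κ : ZpExtension K p) (γ : absoluteGaloisGroup K) [Fact (κ.IsTopGenerator γ)] {N : ℕ} [NeZero N]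
    {f : CuspForm (CongruenceSubgroup.Gamma0 N) 2} (_ : IsNewformOf W f),
    2 < p → Good W p → Red W p → ¬ Anom W p →
    IsImaginaryQuadratic K → SatisfiesHeegnerHypothesis N K →
      ((Ideal.span {(p : ℤ)}).primesOver (𝓞 K)).ncard = 2 →
      Odd (NumberField.discr K) → NumberField.discr K ≠ -3 →
      (∀ Q : (W.baseChange K).toAffine.Point, p • Q = 0 → Q = 0) →
    (∀ (w : InfinitePlace K) (k : 𝓞 K), k ∈ v.asIdeal ↔ ‖ι'.symm (w.embedding (k : K))‖ < 1) →
      ((p : ℕ) : 𝓞 K) ∈ vbar.asIdeal → vbar ≠ v →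
    κ.IsAnticyclotomic →
    ∃ (ΩK : ℂ) (Ωp : (unrIntegers p)ˣ) (L : UnrSeries p),
      ΩK ≠ 0 ∧ IsBDPLFunction ι' v κ γ f ΩK ((Ωp : unrIntegers p) : ℂ_[p]) L ∧
      Module.IsTorsion (IwasawaAlgebra p) (AcSelmer.XAc (W.baseChange K) p κ vbar ∅ γ) ∧
      ∀ (j : ℤ_[p] →+* unrIntegers p),
        (∀ x : ℤ_[p], ((j x : unrIntegers p) : ℂ_[p]) = algebraMap ℚ_[p] ℂ_[p] (x : ℚ_[p])) →
        (AcSelmer.XAc.charIdeal (W.baseChange K) p κ vbar ∅ γ).map (PowerSeries.map j) =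
          Ideal.span {L}

/-- **Theorem 6.5.3 ⇒ the one-sided (IMC2) divisibility `char_Λ(𝔛_Gr)Λ^ur ⊇ (𝓛_p^{BDP})` WITHOUT
(Sel)** in exactly the currency of the CGLS22 fact `proofThm422_exists_isBDPLFunction_isTorsion_
charIdeal_dvd` (`∃ k, p^k · L ∈ char_Λ(𝔛_Gr)·R₀⟦T⟧`; here `k = 0`): on the non-anomalous Eisenstein
locus the corank-one hypothesis of that fact is not needed. [cite: CastellaGrossiSkinner2025, Thm. 6.5.3]
[cite: CastellaGrossiLeeSkinner2022, proof of Thm. 4.2.2 first half (the (Sel)-dependent predecessor)] -/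
theorem exists_isBDPLFunction_isTorsion_charIdeal_dvd_of_thm653
    (h : thm653_exists_isBDPLFunction_isTorsion_charIdeal_map_eq)
    {p : ℕ} [Fact p.Prime] (ι' : PadicAlgCl p ≃+* ℂ) (W : WeierstrassCurve ℚ) [W.IsElliptic]
    [W.IsGloballyMinimal] (K : Type) [Field K] [NumberField K] (v vbar : HeightOneSpectrum (𝓞 K))
    (κ : ZpExtension K p) (γ : absoluteGaloisGroup K) [Fact (κ.IsTopGenerator γ)] {N : ℕ} [NeZero N]
    {f : CuspForm (CongruenceSubgroup.Gamma0 N) 2} (hf : IsNewformOf W f)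
    (hp : 2 < p) (hgood : Good W p) (hred : Red W p) (hna : ¬ Anom W p)
    (hK : IsImaginaryQuadratic K) (hH : SatisfiesHeegnerHypothesis N K)
    (hspl : ((Ideal.span {(p : ℤ)}).primesOver (𝓞 K)).ncard = 2)
    (hodd : Odd (NumberField.discr K)) (hd3 : NumberField.discr K ≠ -3)
    (h1 : ∀ Q : (W.baseChange K).toAffine.Point, p • Q = 0 → Q = 0)
    (hv : ∀ (w : InfinitePlace K) (k : 𝓞 K), k ∈ v.asIdeal ↔ ‖ι'.symm (w.embedding (k : K))‖ < 1)
    (hvbar : ((p : ℕ) : 𝓞 K) ∈ vbar.asIdeal) (hne : vbar ≠ v) (hκ : κ.IsAnticyclotomic) :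
    ∃ (ΩK : ℂ) (Ωp : (unrIntegers p)ˣ) (L : UnrSeries p),
      ΩK ≠ 0 ∧ IsBDPLFunction ι' v κ γ f ΩK ((Ωp : unrIntegers p) : ℂ_[p]) L ∧
      Module.IsTorsion (IwasawaAlgebra p) (AcSelmer.XAc (W.baseChange K) p κ vbar ∅ γ) ∧
      ∀ (j : ℤ_[p] →+* unrIntegers p),
        (∀ x : ℤ_[p], ((j x : unrIntegers p) : ℂ_[p]) = algebraMap ℚ_[p] ℂ_[p] (x : ℚ_[p])) →
        ∃ k : ℕ, C ((p : unrIntegers p) ^ k) * L ∈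
          (AcSelmer.XAc.charIdeal (W.baseChange K) p κ vbar ∅ γ).map (PowerSeries.map j) := by
  obtain ⟨ΩK, Ωp, L, hΩ, hL, htor, heq⟩ :=
    h ι' W K v vbar κ γ hf hp hgood hred hna hK hH hspl hodd hd3 h1 hv hvbar hne hκ
  refine ⟨ΩK, Ωp, L, hΩ, hL, htor, fun j hj ↦ ⟨0, ?_⟩⟩
  rw [heq j hj]
  simp

/-- **Theorem 6.5.3 ⇒ the opposite ("lower bound") inclusion `(𝓛_p^{BDP}) ⊇ char_Λ(𝔛_Gr)Λ^ur`**: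
every element of the extended characteristic ideal is a multiple of `L` in `R₀⟦T⟧` — the half that a
Kolyvagin-system argument alone does not give (in print it comes from the Iwasawa-invariant
equalities of [CGLS22] Thm. 2.2.3 under `φ|_{G_p} ≠ 𝟙, ω`). [cite: CastellaGrossiSkinner2025, Thm. 6.5.3 (equality of ideals)] -/
theorem dvd_of_mem_charIdeal_map_of_thm653
    (h : thm653_exists_isBDPLFunction_isTorsion_charIdeal_map_eq)
    {p : ℕ} [Fact p.Prime] (ι' : PadicAlgCl p ≃+* ℂ) (W : WeierstrassCurve ℚ) [W.IsElliptic]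
    [W.IsGloballyMinimal] (K : Type) [Field K] [NumberField K] (v vbar : HeightOneSpectrum (𝓞 K))
    (κ : ZpExtension K p) (γ : absoluteGaloisGroup K) [Fact (κ.IsTopGenerator γ)] {N : ℕ} [NeZero N]
    {f : CuspForm (CongruenceSubgroup.Gamma0 N) 2} (hf : IsNewformOf W f)
    (hp : 2 < p) (hgood : Good W p) (hred : Red W p) (hna : ¬ Anom W p)
    (hK : IsImaginaryQuadratic K) (hH : SatisfiesHeegnerHypothesis N K)
    (hspl : ((Ideal.span {(p : ℤ)}).primesOver (𝓞 K)).ncard = 2)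
    (hodd : Odd (NumberField.discr K)) (hd3 : NumberField.discr K ≠ -3)
    (h1 : ∀ Q : (W.baseChange K).toAffine.Point, p • Q = 0 → Q = 0)
    (hv : ∀ (w : InfinitePlace K) (k : 𝓞 K), k ∈ v.asIdeal ↔ ‖ι'.symm (w.embedding (k : K))‖ < 1)
    (hvbar : ((p : ℕ) : 𝓞 K) ∈ vbar.asIdeal) (hne : vbar ≠ v) (hκ : κ.IsAnticyclotomic) :
    ∃ (ΩK : ℂ) (Ωp : (unrIntegers p)ˣ) (L : UnrSeries p),
      ΩK ≠ 0 ∧ IsBDPLFunction ι' v κ γ f ΩK ((Ωp : unrIntegers p) : ℂ_[p]) L ∧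
      ∀ (j : ℤ_[p] →+* unrIntegers p),
        (∀ x : ℤ_[p], ((j x : unrIntegers p) : ℂ_[p]) = algebraMap ℚ_[p] ℂ_[p] (x : ℚ_[p])) →
        ∀ G ∈ (AcSelmer.XAc.charIdeal (W.baseChange K) p κ vbar ∅ γ).map (PowerSeries.map j),
          L ∣ G := by
  obtain ⟨ΩK, Ωp, L, hΩ, hL, -, heq⟩ :=
    h ι' W K v vbar κ γ hf hp hgood hred hna hK hH hspl hodd hd3 h1 hv hvbar hne hκ
  refine ⟨ΩK, Ωp, L, hΩ, hL, fun j hj G hG ↦ ?_⟩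
  rw [heq j hj] at hG
  exact Ideal.mem_span_singleton.mp hG

end Thm653

end Literature.NumberTheory.EllipticCurves.CastellaGrossiSkinner2025

end
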